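import Mathlib
import Summits.ValiantsHypothesis.ValiantsHypothesis.Theorems.NewtonUnitEquationsTwoProductsConeChart
import Summits.ValiantsHypothesis.ValiantsHypothesis.Theorems.NewtonUnitEquationsTwoProductsExposure
import Summits.ValiantsHypothesis.ValiantsHypothesis.Theorems.NewtonUnitEquationsTwoProductsFormalLogLinearisationDefs

/-!
# Crux `TwoProducts` (stmt-ValiantsHypothesis-5906), line `formal-log-linearisation`: chart tools for STUB 2

Helper file for `stub_chartNormalisation` of the registered line `Cruxes/TwoProducts/Lines/formal-log-linearisation.lean`
(NOT the item's skeleton of record), over the objects of `Theorems/NewtonUnitEquationsTwoProductsFormalLogLinearisationDefs.lean`: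

* Step 1 — ROUNDING (`exists_int_form_of_tops`): if a real weight makes `a_j` (`b_j`) the strict top of `supp f_j`
  (`supp g_j`) for every `j`, one INTEGER form `w` separates every top from its tails simultaneously (the landed
  `TwoProducts.Exposure.exists_int_form_of_real_form` applied once to the finite set of shifted tails `M − a_j + p`,
  `M = Σ a + Σ b`, whose unique minimiser for `−ξ` is `M`);
* Step 2 — ADAPTED INTEGER CHART (`exists_adapted_rows`): rows `r₁ = w`, `r₂ = M_i·w + e_i` with `det = ±w_{1−i} ≠ 0`
  and `r_k·a_j ≤ r_k·p` on `supp f_j` (degenerate `w = 0` ⇒ no tails ⇒ identity chart) — no `SL₂(ℤ)` needed, this is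
  exactly the input format of the landed corner-log chart engine `TwoProducts.ConeChart.cc_*`;
* Step 3 — REAL WEIGHT TRANSPORT (`exists_transport_weight`, `wt_psi`): `ξ' = L^{−T} ξ` by the explicit `2×2` inverse,
  `wt ξ' (Ψ_N x) = wt ξ x − wt ξ N` above the corner;
* small facts on the local factors (`exists_of_mem_support_local`, `card_support_sub_one_le`).

Honest framing: elementary toolkit; the crux `TwoProducts` is OPEN; nothing here bears on `VP ≠ VNP`.
-/

set_option linter.dupNamespace false

noncomputable section

open scoped BigOperators
open MvPolynomial

namespace Summit.ValiantsHypothesis.ValiantsHypothesis.Theorems.NewtonUnitEquations.TwoProducts.FormalLogLinearisation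

variable {m : ℕ}

/-! ## Step 1: one integer form separating every top from its tails -/

/-- Coordinates of the shifted tail `M − a + p` (`a ≤ M`), as integers. [folklore] -/
theorem shift_apply_int (M a p : Expo) (h : a ≤ M) (k : Fin 2) :
    (((M - a + p) k : ℕ) : ℤ) = ((M k : ℕ) : ℤ) - ((a k : ℕ) : ℤ) + ((p k : ℕ) : ℤ) := by
  have hk : a k ≤ M k := h k
  simp only [Finsupp.coe_add, Finsupp.coe_tsub, Pi.add_apply, Pi.sub_apply, Nat.cast_add, Nat.cast_sub hk]

/-- The shifted tail `M − a + p` (`a ≤ M`) equals `M` only for `p = a`. [folklore] -/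
theorem eq_of_shift_eq (M a p : Expo) (h : a ≤ M) (hp : M - a + p = M) : p = a := by
  have h' : M - a + p = M - a + a := by rw [hp, tsub_add_cancel_of_le h]
  exact add_left_cancel h'

/-- ROUNDING, simultaneous version: if a real weight `ξ` makes `a_j` the strict top of `supp f_j` and `b_j` the strict
top of `supp g_j` for every `j`, some INTEGER form `w` has `w·a_j < w·p` for every other `p ∈ supp f_j` and
`w·b_j < w·p` for every other `p ∈ supp g_j` (landed `Exposure.exists_int_form_of_real_form` on the finite set of
shifted tails). [folklore] -/
theorem exists_int_form_of_tops (f g : Fin m → MvPolynomial (Fin 2) ℂ) (a b : Fin m → Expo) (ξ : Fin 2 → ℝ)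
    (hfa : ∀ j, IsStrictTop ξ ↑(f j).support (a j)) (hgb : ∀ j, IsStrictTop ξ ↑(g j).support (b j)) :
    ∃ w : Fin 2 → ℤ,
      (∀ j, ∀ p ∈ (f j).support, p ≠ a j →
        w 0 * (((a j) 0 : ℕ) : ℤ) + w 1 * (((a j) 1 : ℕ) : ℤ) < w 0 * ((p 0 : ℕ) : ℤ) + w 1 * ((p 1 : ℕ) : ℤ)) ∧
      (∀ j, ∀ p ∈ (g j).support, p ≠ b j →
        w 0 * (((b j) 0 : ℕ) : ℤ) + w 1 * (((b j) 1 : ℕ) : ℤ) < w 0 * ((p 0 : ℕ) : ℤ) + w 1 * ((p 1 : ℕ) : ℤ)) := by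
  classical
  set M : Expo := ∑ j, a j + ∑ j, b j with hM
  have haM : ∀ j, a j ≤ M := fun j =>
    (Finset.single_le_sum (f := a) (fun i _ => (zero_le : (0 : Expo) ≤ a i)) (Finset.mem_univ j)).trans le_self_add
  have hbM : ∀ j, b j ≤ M := fun j =>
    (Finset.single_le_sum (f := b) (fun i _ => (zero_le : (0 : Expo) ≤ b i)) (Finset.mem_univ j)).trans le_add_self
  set S : Finset Expo := (Finset.univ.biUnion fun j => (f j).support.image fun p => M - a j + p) ∪
    (Finset.univ.biUnion fun j => (g j).support.image fun p => M - b j + p) with hS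
  -- `M` is the unique minimiser of `−ξ` on `S`
  have hreal : ∀ s ∈ S, s ≠ M →
      (-ξ) 0 * ((M 0 : ℕ) : ℝ) + (-ξ) 1 * ((M 1 : ℕ) : ℝ) < (-ξ) 0 * ((s 0 : ℕ) : ℝ) + (-ξ) 1 * ((s 1 : ℕ) : ℝ) := by
    intro s hs hsM
    rcases Finset.mem_union.mp hs with hs | hs
    · obtain ⟨j, -, hj⟩ := Finset.mem_biUnion.mp hs
      obtain ⟨p, hp, rfl⟩ := Finset.mem_image.mp hj
      have hpa : p ≠ a j := fun h => hsM (by rw [h, tsub_add_cancel_of_le (haM j)])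
      have hlt := (hfa j).2 p (Finset.mem_coe.mpr hp) hpa
      simp only [wt] at hlt
      have h0 := shift_apply_int M (a j) p (haM j) 0
      have h1 := shift_apply_int M (a j) p (haM j) 1
      have h0' : (((M - a j + p) 0 : ℕ) : ℝ) = ((M 0 : ℕ) : ℝ) - (((a j) 0 : ℕ) : ℝ) + ((p 0 : ℕ) : ℝ) := by
        exact_mod_cast h0
      have h1' : (((M - a j + p) 1 : ℕ) : ℝ) = ((M 1 : ℕ) : ℝ) - (((a j) 1 : ℕ) : ℝ) + ((p 1 : ℕ) : ℝ) := by
        exact_mod_cast h1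
      rw [h0', h1']
      simp only [Pi.neg_apply]
      linarith
    · obtain ⟨j, -, hj⟩ := Finset.mem_biUnion.mp hs
      obtain ⟨p, hp, rfl⟩ := Finset.mem_image.mp hj
      have hpb : p ≠ b j := fun h => hsM (by rw [h, tsub_add_cancel_of_le (hbM j)])
      have hlt := (hgb j).2 p (Finset.mem_coe.mpr hp) hpb
      simp only [wt] at hlt
      have h0 := shift_apply_int M (b j) p (hbM j) 0
      have h1 := shift_apply_int M (b j) p (hbM j) 1
      have h0' : (((M - b j + p) 0 : ℕ) : ℝ) = ((M 0 : ℕ) : ℝ) - (((b j) 0 : ℕ) : ℝ) + ((p 0 : ℕ) : ℝ) := by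
        exact_mod_cast h0
      have h1' : (((M - b j + p) 1 : ℕ) : ℝ) = ((M 1 : ℕ) : ℝ) - (((b j) 1 : ℕ) : ℝ) + ((p 1 : ℕ) : ℝ) := by
        exact_mod_cast h1
      rw [h0', h1']
      simp only [Pi.neg_apply]
      linarith
  obtain ⟨w, hw⟩ := TwoProducts.Exposure.exists_int_form_of_real_form S M (-ξ) hreal
  refine ⟨w, fun j p hp hpa => ?_, fun j p hp hpb => ?_⟩
  · have hsS : M - a j + p ∈ S :=
      Finset.mem_union_left _ (Finset.mem_biUnion.mpr ⟨j, Finset.mem_univ j, Finset.mem_image.mpr ⟨p, hp, rfl⟩⟩)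
    have hsM : M - a j + p ≠ M := fun h => hpa (eq_of_shift_eq M (a j) p (haM j) h)
    have hlt := hw _ hsS hsM
    rw [shift_apply_int M (a j) p (haM j) 0, shift_apply_int M (a j) p (haM j) 1] at hlt
    linarith
  · have hsS : M - b j + p ∈ S :=
      Finset.mem_union_right _ (Finset.mem_biUnion.mpr ⟨j, Finset.mem_univ j, Finset.mem_image.mpr ⟨p, hp, rfl⟩⟩)
    have hsM : M - b j + p ≠ M := fun h => hpb (eq_of_shift_eq M (b j) p (hbM j) h)
    have hlt := hw _ hsS hsM
    rw [shift_apply_int M (b j) p (hbM j) 0, shift_apply_int M (b j) p (hbM j) 1] at hlt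
    linarith

/-! ## Step 2: an adapted integer chart with nonzero determinant -/

/-- The second chart row `K·w + e_i` is adapted: from `w·a ≤ w·p` with equality only for `p = a`, and
`K ≥ a_i`, one gets `K·(w·a) + a_i ≤ K·(w·p) + p_i`. [folklore] -/
theorem chart_row_le (w : Fin 2 → ℤ) (K : ℤ) (hK : 0 ≤ K) (a p : Expo) (i : Fin 2) (haK : ((a i : ℕ) : ℤ) ≤ K)
    (h : p = a ∨ w 0 * ((a 0 : ℕ) : ℤ) + w 1 * ((a 1 : ℕ) : ℤ) < w 0 * ((p 0 : ℕ) : ℤ) + w 1 * ((p 1 : ℕ) : ℤ)) :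
    K * (w 0 * ((a 0 : ℕ) : ℤ) + w 1 * ((a 1 : ℕ) : ℤ)) + ((a i : ℕ) : ℤ) ≤
      K * (w 0 * ((p 0 : ℕ) : ℤ) + w 1 * ((p 1 : ℕ) : ℤ)) + ((p i : ℕ) : ℤ) := by
  rcases h with rfl | hlt
  · exact le_rfl
  · have hp0 : (0 : ℤ) ≤ ((p i : ℕ) : ℤ) := Nat.cast_nonneg _
    nlinarith

/-- An ADAPTED INTEGER CHART from a separating integer form: rows `r₁, r₂` with `det ≠ 0` such that
`r_k · a_j ≤ r_k · p` on `supp f_j` and `r_k · b_j ≤ r_k · p` on `supp g_j` (`k = 1, 2`). [folklore] -/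
theorem exists_adapted_rows (f g : Fin m → MvPolynomial (Fin 2) ℂ) (a b : Fin m → Expo) (w : Fin 2 → ℤ)
    (hwf : ∀ j, ∀ p ∈ (f j).support, p ≠ a j →
      w 0 * (((a j) 0 : ℕ) : ℤ) + w 1 * (((a j) 1 : ℕ) : ℤ) < w 0 * ((p 0 : ℕ) : ℤ) + w 1 * ((p 1 : ℕ) : ℤ))
    (hwg : ∀ j, ∀ p ∈ (g j).support, p ≠ b j →
      w 0 * (((b j) 0 : ℕ) : ℤ) + w 1 * (((b j) 1 : ℕ) : ℤ) < w 0 * ((p 0 : ℕ) : ℤ) + w 1 * ((p 1 : ℕ) : ℤ)) :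
    ∃ r₁ r₂ : Fin 2 → ℤ, r₁ 0 * r₂ 1 ≠ r₁ 1 * r₂ 0 ∧
      (∀ j, ∀ p ∈ (f j).support,
        r₁ 0 * (((a j) 0 : ℕ) : ℤ) + r₁ 1 * (((a j) 1 : ℕ) : ℤ) ≤ r₁ 0 * ((p 0 : ℕ) : ℤ) + r₁ 1 * ((p 1 : ℕ) : ℤ) ∧
        r₂ 0 * (((a j) 0 : ℕ) : ℤ) + r₂ 1 * (((a j) 1 : ℕ) : ℤ) ≤ r₂ 0 * ((p 0 : ℕ) : ℤ) + r₂ 1 * ((p 1 : ℕ) : ℤ)) ∧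
      (∀ j, ∀ p ∈ (g j).support,
        r₁ 0 * (((b j) 0 : ℕ) : ℤ) + r₁ 1 * (((b j) 1 : ℕ) : ℤ) ≤ r₁ 0 * ((p 0 : ℕ) : ℤ) + r₁ 1 * ((p 1 : ℕ) : ℤ) ∧
        r₂ 0 * (((b j) 0 : ℕ) : ℤ) + r₂ 1 * (((b j) 1 : ℕ) : ℤ) ≤ r₂ 0 * ((p 0 : ℕ) : ℤ) + r₂ 1 * ((p 1 : ℕ) : ℤ)) := by
  classical
  -- weak separation
  have hwf' : ∀ j, ∀ p ∈ (f j).support, p = a j ∨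
      w 0 * (((a j) 0 : ℕ) : ℤ) + w 1 * (((a j) 1 : ℕ) : ℤ) < w 0 * ((p 0 : ℕ) : ℤ) + w 1 * ((p 1 : ℕ) : ℤ) :=
    fun j p hp => (eq_or_ne p (a j)).imp_right (hwf j p hp)
  have hwg' : ∀ j, ∀ p ∈ (g j).support, p = b j ∨
      w 0 * (((b j) 0 : ℕ) : ℤ) + w 1 * (((b j) 1 : ℕ) : ℤ) < w 0 * ((p 0 : ℕ) : ℤ) + w 1 * ((p 1 : ℕ) : ℤ) :=
    fun j p hp => (eq_or_ne p (b j)).imp_right (hwg j p hp)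
  -- a uniform bound `K = M_i` on the `i`-th coordinates of the tops
  set M : Expo := ∑ j, a j + ∑ j, b j with hM
  have haM : ∀ j i, (((a j) i : ℕ) : ℤ) ≤ ((M i : ℕ) : ℤ) := fun j i => by
    have h : a j ≤ M :=
      (Finset.single_le_sum (f := a) (fun i _ => (zero_le : (0 : Expo) ≤ a i)) (Finset.mem_univ j)).trans le_self_add
    exact_mod_cast h i
  have hbM : ∀ j i, (((b j) i : ℕ) : ℤ) ≤ ((M i : ℕ) : ℤ) := fun j i => by
    have h : b j ≤ M :=
      (Finset.single_le_sum (f := b) (fun i _ => (zero_le : (0 : Expo) ≤ b i)) (Finset.mem_univ j)).trans le_add_self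
    exact_mod_cast h i
  by_cases hw0 : w 0 = 0 ∧ w 1 = 0
  · -- degenerate form: then there are no tails at all, the identity chart works
    refine ⟨![1, 0], ![0, 1], by simp, fun j p hp => ?_, fun j p hp => ?_⟩
    · rcases hwf' j p hp with rfl | hlt
      · exact ⟨le_rfl, le_rfl⟩
      · rw [hw0.1, hw0.2] at hlt; simp at hlt
    · rcases hwg' j p hp with rfl | hlt
      · exact ⟨le_rfl, le_rfl⟩
      · rw [hw0.1, hw0.2] at hlt; simp at hlt
  · -- pick the coordinate `i` with `det = ± w (1 - i) ≠ 0`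
    obtain ⟨i, hdet⟩ : ∃ i : Fin 2, w 0 * ((M i : ℕ) * w 1 + if (1 : Fin 2) = i then 1 else 0) ≠
        w 1 * ((M i : ℕ) * w 0 + if (0 : Fin 2) = i then 1 else 0) := by
      by_cases h0 : w 0 = 0
      · have h1 : w 1 ≠ 0 := fun h1 => hw0 ⟨h0, h1⟩
        refine ⟨0, ?_⟩
        simp only [h0, zero_mul, mul_zero, zero_add, mul_one, if_true, show ((1 : Fin 2) = 0) = False by decide,
          if_false]
        exact fun h => h1 h.symm
      · refine ⟨1, ?_⟩
        simp only [if_true, show ((0 : Fin 2) = 1) = False by decide, if_false, add_zero]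
        intro h
        apply h0
        nlinarith
    set K : ℤ := ((M i : ℕ) : ℤ) with hK
    have hK0 : 0 ≤ K := Nat.cast_nonneg _
    refine ⟨w, fun k => K * w k + if k = i then 1 else 0, ?_, fun j p hp => ⟨?_, ?_⟩, fun j p hp => ⟨?_, ?_⟩⟩
    · simpa [hK, mul_comm] using hdet
    · rcases hwf' j p hp with rfl | hlt
      · exact le_rfl
      · exact hlt.le
    · have h := chart_row_le w K hK0 (a j) p i (haM j i) (hwf' j p hp)
      have e1 : ∀ q : Expo, (K * w 0 + if (0 : Fin 2) = i then 1 else 0) * ((q 0 : ℕ) : ℤ) +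
          (K * w 1 + if (1 : Fin 2) = i then 1 else 0) * ((q 1 : ℕ) : ℤ) =
          K * (w 0 * ((q 0 : ℕ) : ℤ) + w 1 * ((q 1 : ℕ) : ℤ)) + ((q i : ℕ) : ℤ) := by
        intro q
        fin_cases i <;> simp <;> ring
      rw [e1, e1]
      exact h
    · rcases hwg' j p hp with rfl | hlt
      · exact le_rfl
      · exact hlt.le
    · have h := chart_row_le w K hK0 (b j) p i (hbM j i) (hwg' j p hp)
      have e1 : ∀ q : Expo, (K * w 0 + if (0 : Fin 2) = i then 1 else 0) * ((q 0 : ℕ) : ℤ) +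
          (K * w 1 + if (1 : Fin 2) = i then 1 else 0) * ((q 1 : ℕ) : ℤ) =
          K * (w 0 * ((q 0 : ℕ) : ℤ) + w 1 * ((q 1 : ℕ) : ℤ)) + ((q i : ℕ) : ℤ) := by
        intro q
        fin_cases i <;> simp <;> ring
      rw [e1, e1]
      exact h

/-! ## Step 3: transporting real weights through the chart -/

/-- The transported weight `ξ' = L^{−T} ξ` of an integer chart with rows `r₁, r₂` and `det ≠ 0`:
`ξ'·(L x) = ξ·x` for all real `x`. [folklore] -/
theorem exists_transport_weight (r₁ r₂ : Fin 2 → ℤ) (hdet : r₁ 0 * r₂ 1 ≠ r₁ 1 * r₂ 0) (ξ : Fin 2 → ℝ) :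
    ∃ ξ' : Fin 2 → ℝ, ∀ x₀ x₁ : ℝ,
      ξ' 0 * ((r₁ 0 : ℝ) * x₀ + (r₁ 1 : ℝ) * x₁) + ξ' 1 * ((r₂ 0 : ℝ) * x₀ + (r₂ 1 : ℝ) * x₁) = ξ 0 * x₀ + ξ 1 * x₁ := by
  have hd : ((r₁ 0 : ℝ) * r₂ 1 - r₁ 1 * r₂ 0) ≠ 0 := by
    have h : ((r₁ 0 * r₂ 1 - r₁ 1 * r₂ 0 : ℤ) : ℝ) ≠ 0 := by exact_mod_cast sub_ne_zero.mpr hdet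
    push_cast at h
    exact h
  refine ⟨![((r₂ 1 : ℝ) * ξ 0 - (r₂ 0 : ℝ) * ξ 1) / ((r₁ 0 : ℝ) * r₂ 1 - r₁ 1 * r₂ 0),
    (-(r₁ 1 : ℝ) * ξ 0 + (r₁ 0 : ℝ) * ξ 1) / ((r₁ 0 : ℝ) * r₂ 1 - r₁ 1 * r₂ 0)], fun x₀ x₁ => ?_⟩
  simp only [Matrix.cons_val_zero, Matrix.cons_val_one, Matrix.cons_val_fin_one]
  rw [div_mul_eq_mul_div, div_mul_eq_mul_div, ← add_div, div_eq_iff hd]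
  ring

/-- Weight of a charted point: `wt ξ' (Ψ_N x) = wt ξ x − wt ξ N` above the corner `N`. [folklore] -/
theorem wt_psi (L : Expo →+ (Fin 2 → ℤ)) (r₁ r₂ : Fin 2 → ℤ)
    (hL0 : ∀ e, L e 0 = r₁ 0 * ((e 0 : ℕ) : ℤ) + r₁ 1 * ((e 1 : ℕ) : ℤ))
    (hL1 : ∀ e, L e 1 = r₂ 0 * ((e 0 : ℕ) : ℤ) + r₂ 1 * ((e 1 : ℕ) : ℤ)) (ξ ξ' : Fin 2 → ℝ)
    (hξ' : ∀ x₀ x₁ : ℝ,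
      ξ' 0 * ((r₁ 0 : ℝ) * x₀ + (r₁ 1 : ℝ) * x₁) + ξ' 1 * ((r₂ 0 : ℝ) * x₀ + (r₂ 1 : ℝ) * x₁) = ξ 0 * x₀ + ξ 1 * x₁)
    (N x : Expo) (h : L N ≤ L x) :
    wt ξ' (Finsupp.equivFunOnFinite.symm fun i => (L x i - L N i).toNat) = wt ξ x - wt ξ N := by
  have h0 := TwoProducts.ConeChart.cc_psi_apply L N x h 0
  have h1 := TwoProducts.ConeChart.cc_psi_apply L N x h 1
  rw [hL0, hL0] at h0
  rw [hL1, hL1] at h1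
  have h0' : (((Finsupp.equivFunOnFinite.symm fun i => (L x i - L N i).toNat) 0 : ℕ) : ℝ) =
      ((r₁ 0 : ℝ) * ((x 0 : ℕ) : ℝ) + (r₁ 1 : ℝ) * ((x 1 : ℕ) : ℝ)) -
        ((r₁ 0 : ℝ) * ((N 0 : ℕ) : ℝ) + (r₁ 1 : ℝ) * ((N 1 : ℕ) : ℝ)) := by
    exact_mod_cast h0
  have h1' : (((Finsupp.equivFunOnFinite.symm fun i => (L x i - L N i).toNat) 1 : ℕ) : ℝ) =
      ((r₂ 0 : ℝ) * ((x 0 : ℕ) : ℝ) + (r₂ 1 : ℝ) * ((x 1 : ℕ) : ℝ)) -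
        ((r₂ 0 : ℝ) * ((N 0 : ℕ) : ℝ) + (r₂ 1 : ℝ) * ((N 1 : ℕ) : ℝ)) := by
    exact_mod_cast h1
  have hx := hξ' ((x 0 : ℕ) : ℝ) ((x 1 : ℕ) : ℝ)
  have hN := hξ' ((N 0 : ℕ) : ℝ) ((N 1 : ℕ) : ℝ)
  simp only [wt]
  rw [h0', h1']
  linear_combination hx - hN

/-! ## Small facts about the local factors -/

/-- Exponents of a local factor are charted support points. [folklore] -/
theorem exists_of_mem_support_local (L : Expo →+ (Fin 2 → ℤ)) (φ : MvPolynomial (Fin 2) ℂ) (μ₀ : Expo)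
    (d : Expo) (hd : d ∈ (∑ p ∈ φ.support,
      monomial (Finsupp.equivFunOnFinite.symm fun i => (L p i - L μ₀ i).toNat) (coeff p φ / coeff μ₀ φ)).support) :
    ∃ p ∈ φ.support, d = Finsupp.equivFunOnFinite.symm fun i => (L p i - L μ₀ i).toNat := by
  classical
  obtain ⟨p, hp, hmem⟩ := Finset.mem_biUnion.mp (support_sum hd)
  exact ⟨p, hp, Finset.mem_singleton.mp (support_monomial_subset hmem)⟩

/-- Removing the constant term `1` of a `t`-sparse polynomial leaves `≤ t − 1` monomials. [folklore] -/
theorem card_support_sub_one_le (q : MvPolynomial (Fin 2) ℂ) (t : ℕ) (hq : q.support.card ≤ t)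
    (h0 : coeff 0 q = 1) : (q - 1).support.card ≤ t - 1 := by
  classical
  have hmem : (0 : Expo) ∈ q.support := by rw [mem_support_iff, h0]; exact one_ne_zero
  have hsub : (q - 1).support ⊆ q.support.erase 0 := by
    intro d hd
    rw [mem_support_iff, coeff_sub, coeff_one] at hd
    rw [Finset.mem_erase, mem_support_iff]
    by_cases hd0 : d = 0
    · subst hd0; simp [h0] at hd
    · refine ⟨hd0, ?_⟩
      simpa [Ne.symm hd0] using hd
  have hle := Finset.card_le_card hsub
  rw [Finset.card_erase_of_mem hmem] at hle
  omega

end Summit.ValiantsHypothesis.ValiantsHypothesis.Theorems.NewtonUnitEquations.TwoProducts.FormalLogLinearisation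

end
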